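import Summits.CriticalPhenomena.PercolationContinuityZ3.Theorems.PercNearOneGluingNoHeavyPcintMeanMemZ6M10Defs
import HarnessLib

/-!
# PCINT lane, kernel reduced-state B3m certificate `Z6M10` (bond, d = 6, memory τ = 10, kc = 4, 6192 state classes): row checks 3b (rows [2500, 3000))

Cell `prim-pcint`, seat `prim-pcint-2` (gen 4); memo `run/shared/lean/prim/pcint/REDUCTIONS.md` §B3m and HANDOFF ("B3m on reduced states").
Does NOT build on p205010.  Data for `BondK.le_criticalProb_of_checkRowsM` (`…PcintMeanMemKernelCert`): `p = 9310/100000`, chain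
parameter `kc = 4`, `s̄ = 99566/100000` (`s̄²+p² ≥ 1`), `t̄ = 98415/100000` (`(1-p)(1+2p) ≤ t̄(1+p)`, `1-p ≤ s̄ t̄²`, `t̄ ≤ s̄²`), `t̄' = 99208/100000`
(`p² ≤ (t̄'-t̄)(1+p)`), mean corner-third unit `m̄ = 98812/100000 ≥ (t̄+t̄')/2`, `κ̄ = (100000²+99566²)/(2·100000²)`, `λ = 99999/100000`; Collatz–Wielandt
weights (scale 10⁹) from a power iteration (ρ ≈ 0.9996623), exact off-line max row ratio 0.9996623295 < λ.  Generated by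
work/gen/gen_b3m_kernel.py (prim-pcint-2 gen 4 folder; copy in run/shared/lean/prim/pcint/prim-pcint-2/kernel/); the kernel re-checks every row.
-/

namespace Summit.CriticalPhenomena.PercolationContinuityZ3.Theorems.Pcint.MeanMemZ6M10

set_option maxHeartbeats 0 in
/-- Rows `[2500, 2600)` pass the check. [folklore] -/
theorem chk_2500 : WinK.allRange (BondK.checkRowM 10 4 6 6192 9310 99566 98415 98812 100000 99999 100000 MeanMemZ6M10.syms MeanMemZ6M10.tree) 2500 2600 = true :=
  WinK.allRange_of_allRangeB (fuel := 8) (lo := 2500) (len := 100) (by decide +kernel)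

set_option maxHeartbeats 0 in
/-- Rows `[2600, 2700)` pass the check. [folklore] -/
theorem chk_2600 : WinK.allRange (BondK.checkRowM 10 4 6 6192 9310 99566 98415 98812 100000 99999 100000 MeanMemZ6M10.syms MeanMemZ6M10.tree) 2600 2700 = true :=
  WinK.allRange_of_allRangeB (fuel := 8) (lo := 2600) (len := 100) (by decide +kernel)

set_option maxHeartbeats 0 in
/-- Rows `[2700, 2800)` pass the check. [folklore] -/
theorem chk_2700 : WinK.allRange (BondK.checkRowM 10 4 6 6192 9310 99566 98415 98812 100000 99999 100000 MeanMemZ6M10.syms MeanMemZ6M10.tree) 2700 2800 = true :=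
  WinK.allRange_of_allRangeB (fuel := 8) (lo := 2700) (len := 100) (by decide +kernel)

set_option maxHeartbeats 0 in
/-- Rows `[2800, 2900)` pass the check. [folklore] -/
theorem chk_2800 : WinK.allRange (BondK.checkRowM 10 4 6 6192 9310 99566 98415 98812 100000 99999 100000 MeanMemZ6M10.syms MeanMemZ6M10.tree) 2800 2900 = true :=
  WinK.allRange_of_allRangeB (fuel := 8) (lo := 2800) (len := 100) (by decide +kernel)

set_option maxHeartbeats 0 in
/-- Rows `[2900, 3000)` pass the check. [folklore] -/
theorem chk_2900 : WinK.allRange (BondK.checkRowM 10 4 6 6192 9310 99566 98415 98812 100000 99999 100000 MeanMemZ6M10.syms MeanMemZ6M10.tree) 2900 3000 = true :=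
  WinK.allRange_of_allRangeB (fuel := 8) (lo := 2900) (len := 100) (by decide +kernel)

/-- Rows `[2500, 3000)` pass the check. [folklore] -/
theorem file_3b : WinK.allRange (BondK.checkRowM 10 4 6 6192 9310 99566 98415 98812 100000 99999 100000 MeanMemZ6M10.syms MeanMemZ6M10.tree) 2500 3000 = true := (WinK.allRange_split (WinK.allRange_split (WinK.allRange_split (WinK.allRange_split chk_2500 chk_2600) chk_2700) chk_2800) chk_2900)

end Summit.CriticalPhenomena.PercolationContinuityZ3.Theorems.Pcint.MeanMemZ6M10
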